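import Summits.ResolutionOfSingularities.ResolutionOfSingularities.Theorems.WildDescent3
import HarnessLib

/-!
# WildDescent (4/13) — β-descent in a linear frame; §3 Congruences; §4 Linear forms in three letters, the normalised frame `frame_in`

Verbatim slice of the farm-checked monolith `WildDescent.lean` of cell `decomp-res`, seat `decomp-res-lens-5`, g36
(sha256 4ec0fa6f4f9efba7…); one namespace `Summit.ResolutionOfSingularities.ResolutionOfSingularities.Theorems.WildDescent` across the
slices, imports chained (laws L1–L7 and the mechanism: module docstring of slice 1; main theorems: slice 13/13).
-/

open MvPolynomial Finset
open scoped BigOperators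
open Literature.AlgebraicGeometry.Resolution
open Literature.AlgebraicGeometry.Resolution.Hauser2010
open Literature.AlgebraicGeometry.Resolution.PointBlowup
open Literature.AlgebraicGeometry.Resolution.HauserPerlega2024

namespace Summit.ResolutionOfSingularities.ResolutionOfSingularities.Theorems.WildDescent

/-! ## §3 Congruences: substitutions congruent to the identity, coefficients below a variable, cancellation -/

section Congruence

variable {σ : Type*} {K : Type*} [Field K]

/-- A substitution `y_i ↦ g_i` with `g_i ≡ y_i (mod I)` is congruent to the identity modulo `I`. [folklore] -/
theorem aeval_sub_mem_of_forall {I : Ideal (MvPolynomial σ K)} {g : σ → MvPolynomial σ K} (hg : ∀ i, g i - X i ∈ I)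
    (P : MvPolynomial σ K) : aeval g P - P ∈ I := by
  rw [← Ideal.Quotient.eq]
  have h : (Ideal.Quotient.mkₐ K I).comp (aeval g) = (Ideal.Quotient.mkₐ K I).comp (aeval X) := by
    refine MvPolynomial.algHom_ext fun i => ?_
    simp only [AlgHom.comp_apply, aeval_X, Ideal.Quotient.mkₐ_eq_mk]
    exact Ideal.Quotient.eq.mpr (hg i)
  have := congrArg (fun φ => φ P) h
  simpa only [AlgHom.comp_apply, aeval_X_left, AlgHom.coe_id, id_eq, Ideal.Quotient.mkₐ_eq_mk] using this

/-- Coefficients of monomials NOT divisible by `y_E` do not see multiples of `y_E`. [folklore] -/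
theorem coeff_eq_zero_of_mem_span_X [DecidableEq σ] {E : σ} {Q : MvPolynomial σ K} (hQ : Q ∈ Ideal.span {(X E : MvPolynomial σ K)})
    {d : σ →₀ ℕ} (hd : d E = 0) : coeff d Q = 0 := by
  obtain ⟨R, rfl⟩ := Ideal.mem_span_singleton'.mp hQ
  rw [mul_comm, coeff_X_mul', if_neg (by rw [Finsupp.mem_support_iff, not_not]; exact hd)]

/-- Hence congruent polynomials have the same coefficients below `y_E`. [folklore] -/
theorem coeff_eq_of_sub_mem_span_X [DecidableEq σ] {E : σ} {P Q : MvPolynomial σ K}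
    (h : P - Q ∈ Ideal.span {(X E : MvPolynomial σ K)}) {d : σ →₀ ℕ} (hd : d E = 0) : coeff d P = coeff d Q := by
  have := coeff_eq_zero_of_mem_span_X h hd
  rwa [coeff_sub, sub_eq_zero] at this

/-- **E-law of the shear:** a shear of `y_f` by a multiple of `y_E` does not change the coefficients of the
monomials prime to `y_E`. [folklore] -/
theorem coeff_zshear_of_apply_eq_zero [DecidableEq σ] {f E : σ} (ζ : MvPolynomial σ K)
    (hζ : ζ ∈ Ideal.span {(X E : MvPolynomial σ K)}) (P : MvPolynomial σ K) {d : σ →₀ ℕ} (hd : d E = 0) :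
    coeff d (WallFrames.zshear f ζ P) = coeff d P := by
  refine coeff_eq_of_sub_mem_span_X (aeval_sub_mem_of_forall (fun i => ?_) P) hd
  by_cases hi : i = f
  · subst hi; rw [if_pos rfl, add_sub_cancel_left]; exact hζ
  · rw [if_neg hi, sub_self]; exact Ideal.zero_mem _

/-- The constant coefficient of a multiple of `y_E` vanishes; so congruent polynomials share constant coefficients. [folklore] -/
theorem constantCoeff_eq_of_sub_mem_span_X [DecidableEq σ] {E : σ} {P Q : MvPolynomial σ K}
    (h : P - Q ∈ Ideal.span {(X E : MvPolynomial σ K)}) : constantCoeff P = constantCoeff Q := by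
  exact coeff_eq_of_sub_mem_span_X h (d := 0) (Finsupp.zero_apply)

/-- Cancellation of `y_E^s` against `y_E^{s+1}`: `y_E^s · D ∈ (y_E^{s+1}) ⇒ D ∈ (y_E)`. [folklore] -/
theorem mem_span_X_of_pow_mul_mem {E : σ} {s : ℕ} {D : MvPolynomial σ K}
    (h : X E ^ s * D ∈ Ideal.span {(X E : MvPolynomial σ K) ^ (s + 1)}) : D ∈ Ideal.span {(X E : MvPolynomial σ K)} := by
  rw [Ideal.mem_span_singleton] at h ⊢
  rw [pow_succ] at h
  exact (mul_dvd_mul_iff_left (pow_ne_zero s (X_ne_zero E))).mp h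

/-- Terms of degree `> s` of a frame polynomial: `H − in_s H` has all monomials of degree `≥ s + 1`. [folklore] -/
theorem le_degree_of_mem_support_sub {H : MvPolynomial σ K} {s : ℕ} (hord : (s : ℕ∞) ≤ ordZero H) {d : σ →₀ ℕ}
    (hd : d ∈ (H - homogeneousComponent s H).support) : s + 1 ≤ d.degree :=
  le_degree_of_mem_support (succ_le_ordZero_sub_homogeneousComponent hord) hd

end Congruence

/-! ## §4 Linear forms in three letters; the NORMALISED FRAME of a near stage -/

section Linear

variable {K : Type*} [Field K]

/-- Three distinct letters exhaust `Fin 3`. [folklore] -/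
theorem fin3_exhaust {f k l : Fin 3} (hfk : f ≠ k) (hfl : f ≠ l) (hkl : k ≠ l) (i : Fin 3) : i = f ∨ i = k ∨ i = l := by
  rw [Ne, Fin.ext_iff] at hfk hfl hkl
  rw [Fin.ext_iff, Fin.ext_iff, Fin.ext_iff]
  omega

/-- An exponent of degree `1` in three exhausting letters is a unit vector. [folklore] -/
theorem eq_single_of_degree_one {f k l : Fin 3} (hfk : f ≠ k) (hfl : f ≠ l) (hkl : k ≠ l) {d : Fin 3 →₀ ℕ}
    (hd : d.degree = 1) : d = Finsupp.single f 1 ∨ d = Finsupp.single k 1 ∨ d = Finsupp.single l 1 := by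
  have hdeg := degree_eq_three hfk hfl hkl (fin3_exhaust hfk hfl hkl) d
  rw [hd] at hdeg
  have key : ∀ {a b c : Fin 3}, a ≠ b → a ≠ c → b ≠ c → d a = 1 → d b = 0 → d c = 0 → d = Finsupp.single a 1 := by
    intro a b c hab hac hbc ha hb hc
    ext i
    rcases fin3_exhaust hab hac hbc i with rfl | rfl | rfl
    · rw [Finsupp.single_eq_same, ha]
    · rw [Finsupp.single_apply, if_neg hab, hb]
    · rw [Finsupp.single_apply, if_neg hac, hc]
  rcases Nat.eq_zero_or_pos (d f) with hf0 | hfpos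
  · rcases Nat.eq_zero_or_pos (d k) with hk0 | hkpos
    · exact Or.inr (Or.inr (key (Ne.symm hfl) (Ne.symm hkl) hfk (by omega) hf0 hk0))
    · exact Or.inr (Or.inl (key (Ne.symm hfk) hkl hfl (by omega) hf0 (by omega)))
  · exact Or.inl (key hfk hfl hkl (by omega) (by omega) (by omega))

/-- **A linear form in three letters is the sum of its three coefficients times the variables.** [folklore] -/
theorem linear_eq_three {f k l : Fin 3} (hfk : f ≠ k) (hfl : f ≠ l) (hkl : k ≠ l) {ℓ : MvPolynomial (Fin 3) K}
    (hℓ : ℓ.IsHomogeneous 1) :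
    ℓ = C (coeff (Finsupp.single f 1) ℓ) * X f + C (coeff (Finsupp.single k 1) ℓ) * X k +
      C (coeff (Finsupp.single l 1) ℓ) * X l := by
  classical
  apply MvPolynomial.ext
  intro d
  simp only [coeff_add, coeff_C_mul, coeff_X]
  have hfk' : Finsupp.single f 1 ≠ Finsupp.single k 1 := fun h => hfk ((Finsupp.single_left_inj one_ne_zero).mp h)
  have hfl' : Finsupp.single f 1 ≠ Finsupp.single l 1 := fun h => hfl ((Finsupp.single_left_inj one_ne_zero).mp h)
  have hkl' : Finsupp.single k 1 ≠ Finsupp.single l 1 := fun h => hkl ((Finsupp.single_left_inj one_ne_zero).mp h)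
  by_cases h0 : coeff d ℓ = 0
  · -- then `d` is none of the three unit vectors? no: the coefficient may vanish at a unit vector too
    by_cases hdf : Finsupp.single f 1 = d
    · subst hdf; rw [if_pos rfl, if_neg (Ne.symm hfk'), if_neg (Ne.symm hfl')]; ring
    by_cases hdk : Finsupp.single k 1 = d
    · subst hdk; rw [if_pos rfl, if_neg hfk', if_neg (Ne.symm hkl')]; ring
    by_cases hdl : Finsupp.single l 1 = d
    · subst hdl; rw [if_pos rfl, if_neg hfl', if_neg hkl']; ring
    rw [if_neg hdf, if_neg hdk, if_neg hdl, h0]; ring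
  · have hdeg : d.degree = 1 := by
      rw [Finsupp.degree_eq_weight_one]; exact hℓ h0
    rcases eq_single_of_degree_one hfk hfl hkl hdeg with rfl | rfl | rfl
    · rw [if_pos rfl, if_neg (Ne.symm hfk'), if_neg (Ne.symm hfl')]; ring
    · rw [if_pos rfl, if_neg hfk', if_neg (Ne.symm hkl')]; ring
    · rw [if_pos rfl, if_neg hfl', if_neg hkl']; ring

/-- `C a * X u + C b * X v` is a linear form. [folklore] -/
theorem isHomogeneous_one_lin {σ : Type*} (u v : σ) (a b : K) :
    (C a * X u + C b * X v : MvPolynomial σ K).IsHomogeneous 1 := by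
  have h1 : (C a * X u : MvPolynomial σ K).IsHomogeneous (0 + 1) := (isHomogeneous_C σ a).mul (isHomogeneous_X K u)
  have h2 : (C b * X v : MvPolynomial σ K).IsHomogeneous (0 + 1) := (isHomogeneous_C σ b).mul (isHomogeneous_X K v)
  rw [zero_add] at h1 h2
  exact h1.add h2

/-- `C a * X u + C b * X v` is `f`-free for `f ∉ {u, v}`. [folklore] -/
theorem varFree_lin {σ : Type*} [DecidableEq σ] {f u v : σ} (huf : u ≠ f) (hvf : v ≠ f) (a b : K) :
    ∀ μ ∈ (C a * X u + C b * X v : MvPolynomial σ K).support, μ f = 0 :=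
  WallFrames.varFree_add (WallFrames.varFree_mul (WallFrames.varFree_C f a) (WallFrames.varFree_X_of_ne huf))
    (WallFrames.varFree_mul (WallFrames.varFree_C f b) (WallFrames.varFree_X_of_ne hvf))

/-- `1 ≤ ord (C a * X u + C b * X v)`. [folklore] -/
theorem one_le_ordZero_lin {σ : Type*} (u v : σ) (a b : K) : (1 : ℕ∞) ≤ ordZero (C a * X u + C b * X v : MvPolynomial σ K) := by
  rw [one_le_ordZero_iff]
  simp

/-- `C a * X u + C b * X v ∈ 𝔪` as membership in `(y_u, y_v)`-multiples: constant coefficient zero. [folklore] -/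
theorem constantCoeff_lin {σ : Type*} (u v : σ) (a b : K) : constantCoeff (C a * X u + C b * X v : MvPolynomial σ K) = 0 := by
  simp

/-- **THE NORMALISED FRAME.**  At a near stage with tangent form `c·ℓ^s`, `ℓ` TRANSVERSAL to the walls (`∂ℓ/∂y_f ≠ 0`), the
shear `σ : y_f ↦ y_f − a_k y_k − a_l y_l` (`a_i = ℓ_i/ℓ_f`) produces the frame polynomial `H = σ(G)` with
`in_s H = (c ℓ_f^s)·y_f^s` and `ord H = ord G`.  [cite: CossartJannsenSaito2020, Def 7.3/(8.4) pp.97,109] -/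
theorem frame_in {f k l : Fin 3} (hfk : f ≠ k) (hfl : f ≠ l) (hkl : k ≠ l) {s : ℕ} {G ℓ : MvPolynomial (Fin 3) K} {c : K}
    (hℓ : ℓ.IsHomogeneous 1) (hin : homogeneousComponent s G = C c * ℓ ^ s) (hκ : coeff (Finsupp.single f 1) ℓ ≠ 0) :
    homogeneousComponent s (WallFrames.zshear f
        (-(C (coeff (Finsupp.single k 1) ℓ / coeff (Finsupp.single f 1) ℓ) * X k +
           C (coeff (Finsupp.single l 1) ℓ / coeff (Finsupp.single f 1) ℓ) * X l)) G) =
      C (c * coeff (Finsupp.single f 1) ℓ ^ s) * X f ^ s := by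
  set κ := coeff (Finsupp.single f 1) ℓ with hκdef
  set ak := coeff (Finsupp.single k 1) ℓ / κ
  set al := coeff (Finsupp.single l 1) ℓ / κ
  have hneg : (-(C ak * X k + C al * X l) : MvPolynomial (Fin 3) K) = C (-ak) * X k + C (-al) * X l := by
    rw [map_neg, map_neg]; ring
  have hζ1 : (-(C ak * X k + C al * X l) : MvPolynomial (Fin 3) K).IsHomogeneous 1 := by
    rw [hneg]; exact isHomogeneous_one_lin k l (-ak) (-al)
  rw [homogeneousComponent_zshear hζ1, hin, zshear_C_mul_pow]
  have hℓeq := linear_eq_three hfk hfl hkl hℓ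
  have hz : WallFrames.zshear f (-(C ak * X k + C al * X l)) ℓ = C κ * X f := by
    conv_lhs => rw [hℓeq]
    rw [map_add, map_add, map_mul, map_mul, map_mul, WallFrames.zshear_C, WallFrames.zshear_C, WallFrames.zshear_C,
      WallFrames.zshear_X_self, WallFrames.zshear_X_of_ne (Ne.symm hfk), WallFrames.zshear_X_of_ne (Ne.symm hfl)]
    rw [← hκdef]
    have hk' : (C (coeff (Finsupp.single k 1) ℓ) : MvPolynomial (Fin 3) K) = C κ * C ak := by
      rw [← map_mul]; congr 1; simp only [ak]; field_simp
    have hl' : (C (coeff (Finsupp.single l 1) ℓ) : MvPolynomial (Fin 3) K) = C κ * C al := by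
      rw [← map_mul]; congr 1; simp only [al]; field_simp
    rw [hk', hl']; ring
  rw [hz, mul_pow, ← map_pow, ← mul_assoc, ← map_mul]

end Linear

end Summit.ResolutionOfSingularities.ResolutionOfSingularities.Theorems.WildDescent
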